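import Summits.ValiantsHypothesis.ValiantsHypothesis.Theorems.LacunarySymmetroidMatrixDescartesCensusTwoRowElbowFive

/-!
# `MatrixDescartes` census — W4: elbow 5 in the kernel — COLUMN-DIVISOR quotient Rolle for the three-column residual
# (method file; the row for the two-row-resistant support `(0,2,3,7,21,38)` is `…CensusTwoRowResistant38`)

HONEST FRAMING.  Object-search cell `pub-symmetroid`, item `DoorA26 = PosRootLawAt 2 6 19` (stmt-ValiantsHypothesis-19979,
OPEN, typed, never asserted).  Companion of `…CensusTwoRowElbowFive` / `…TwoRowEdge520` / `…TwoRowElbowFiveRows20*`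
(engine-1 g23): those files kill the long edge `5..20` of chamber 1706 (pair-sum order of `(0,2,3,7,16,27)`) on 113 of
the 115 core supports by keeping the rows `a₀, a₁` against TWO columns and bounding the residual tetranomial.  The
two misses, `(0,2,3,7,21,38)` and `(0,2,3,7,22,40)`, resist every two-column certificate (seat note TWOROW-E1G19 §4)
and every bound on the number of critical points of the three-column quotient (ELBOW5-E1G23 §(S4b)); they were dead
only at cell level (engine-2 g24/g25 hull certificates RESIST518/519/520, R1648).  This file carries the METHOD that
puts the first of them in the kernel (`…CensusTwoRowResistant38`: `≤ 13 < 15 = #terms − 1`, the bound of the rows).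

METHOD (column-divisor quotient Rolle).  Keep the rows `a₀, a₁` against ALL THREE columns `c₃, c₄, c₅` and kill the
other ten exponents by Euler twists.  With `a₀ = −l·a₁` (`l > 0` by the cell signs) the residual is
`R = Σ_j B_j X^{d_j}(X² − l·ν_j)`, `B_j = a₁c_j·M_{1j} > 0`, `ν_j = M_{0j}/M_{1j}` the ratio of the two integer
multipliers of column `j` (here `d = (7, 21, 38)`, `ν₃ = 29638973/13266000 < ν₄ = 377300/105417 < ν₅ = 19208/3315`).
(1) Every positive root of `R` lies beyond the column zero `t₃ = √(lν₃)` (below it all three columns are `≤ 0`, two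
strictly).  (2) Quotient Rolle WITH MULTIPLICITY on the half-line `(t₃, ∞)` (`countP_roots_gt_le_wronskian_add_one`,
the Taylor shift of `countP_posRoots_le_wronskian_add_one`) with the divisor `P₃ = B₃X⁷(X² − lν₃)`, zero-free there,
leaves `W₁ = Wr(P₃,P₄) + Wr(P₃,P₅)`, `Wr(P₃,P_j) = B₃B_j X^{6+d_j} Q_j(X²)`,
`Q_j(s) = (d_j−7)·l²ν₃ν_j − [(d_j−5)ν₃ + (d_j−9)ν_j]·l·s + (d_j−7)·s²`.  (3) `Q₄` is DEFINITE
(`(16ν₃+12ν₄)² < 784ν₃ν₄`, `resid38_quad_pos`), so `Wr(P₃,P₄)` is a zero-free divisor on `(0,∞)`; quotient Rolle with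
it leaves `W₂ = B₃²B₄B₅·X⁷⁰·(X² − lν₃)·Γ(X²)` with an explicit cubic `Γ(s) = l³·γ(s/l)` (the factor `X² − lν₃` is
structural: `W₂(t₃) = 0` on every support).  (4) `γ < 0` up to `21/5` (`resid38_cubic_neg`) and `γ′ > 0` beyond
(`resid38_cubic_deriv_pos`), so one plain Rolle step bounds the roots of `Γ(X²)` beyond `t₃` by one.  Total:
`#Z₊^{mult}(R) ≤ 1 + 1 + 1 = 3` (`countP_posRoots_resid38_le_three`; Descartes allows 5).  Every side condition is
`l`-homogeneous, hence NUMERIC in the multipliers (`norm_num` / `nlinarith` certificates; exact screen by the seat's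
`gen38.py`: discriminant margin `56·14ν₃ν₄ − (16ν₃+12ν₄)² ≈ 76.07`, `γ(797/250) ≈ −396.6` at the near-critical point,
`γ′(21/5) ≈ 2276.6`).  Seat datum (engine-1 g24, exact, `colcert2.py` / `search.py`): the same certificate, and every
mixed twist / column-divisor strategy up to depth 4, FAILS on `(0,2,3,7,22,40)` (edges `5..18/19/20`: certificate
value 4 = Descartes) — those three pairs stay cell-level.  Nothing in this file bounds `ζ_sym(2,6)`, decides
`DoorA26`, or bears on the crux `MatrixDescartes` (stmt-ValiantsHypothesis-18050) / `VP ≠ VNP`: a dead channel is a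
statement about hypothetical objects.

[folklore] Rolle with multiplicity (quotient Rolle on a half-line) + elementary inequalities; no single source.
-/

-- `Summit.ValiantsHypothesis.ValiantsHypothesis.…` repeats a component by the D-0017 layout
-- (single-conjunct summit), which the `dupNamespace` linter flags; the name is mandated.
set_option linter.dupNamespace false

namespace Summit.ValiantsHypothesis.ValiantsHypothesis.Theorems.LacunarySymmetroidMatrixDescartes.Census

open Polynomial Finset
open scoped BigOperators Polynomial

/-! ### Quotient Rolle with multiplicity on a half-line -/

/-- The roots of the Taylor shift `p.comp (X + C a)` beyond `0` are the roots of `p` beyond `a`, multiplicities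
included. [folklore] -/
theorem countP_roots_comp_X_add_C_pos (p : ℝ[X]) (a : ℝ) :
    (p.comp (X + C a)).roots.countP (fun x => 0 < x) = p.roots.countP (fun x => a < x) := by
  classical
  have h := map_roots_comp_C_mul_X_add_C p 1 a isUnit_one
  rw [C_1, one_mul] at h
  conv_rhs => rw [← h]
  rw [Multiset.countP_map, Multiset.countP_eq_card_filter]
  congr 1
  refine Multiset.filter_congr fun x _ => ?_
  constructor <;> intro hx <;> linarith

/-- **Quotient Rolle with multiplicity on a half-line.**  Let `f, g` be real polynomials, `g` without zeros beyond
`a`, and `W = g·f′ − f·g′ ≠ 0`.  Then `#Z_{>a}^{mult}(f) ≤ #Z_{>a}^{mult}(W) + 1` (the Taylor shift of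
`countP_posRoots_le_wronskian_add_one`). [folklore] -/
theorem countP_roots_gt_le_wronskian_add_one (f g W : ℝ[X]) (a : ℝ)
    (hWdef : W = g * derivative f - f * derivative g) (hW : W ≠ 0) (hg : ∀ x : ℝ, a < x → g.eval x ≠ 0) :
    f.roots.countP (fun x => a < x) ≤ W.roots.countP (fun x => a < x) + 1 := by
  rw [← countP_roots_comp_X_add_C_pos f a, ← countP_roots_comp_X_add_C_pos W a]
  have hq : derivative (X + C a : ℝ[X]) = 1 := by simp
  refine countP_posRoots_le_wronskian_add_one (f.comp (X + C a)) (g.comp (X + C a)) (W.comp (X + C a)) ?_ ?_ ?_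
  · rw [derivative_comp, derivative_comp, hq, one_mul, one_mul, hWdef, sub_comp, mul_comp, mul_comp]
  · intro h
    apply hW
    have e : W = (W.comp (X + C a)).comp (X - C a) := by
      rw [comp_assoc]; simp
    rw [e, h, zero_comp]
  · intro x hx
    rw [eval_comp, eval_add, eval_X, eval_C]
    exact hg _ (by linarith)

/-! ### Numeric facts for the support `(0,2,3,7,21,38)` (exact rationals; `nlinarith` certificates) -/

/-- The quadratic `14s² − (16ν₃+12ν₄)·l·s + 14ν₃ν₄·l²` is positive (negative discriminant). [folklore] -/
theorem resid38_quad_pos (s l : ℝ) (hl : 0 < l) :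
    0 < 14 * s ^ 2 - ((16 * (29638973 / 13266000) + 12 * (377300 / 105417)) * l) * s
      + 14 * (l ^ 2 * ((29638973 / 13266000 : ℝ) * (377300 / 105417))) := by
  nlinarith [sq_nonneg (28 * s - (16 * (29638973 / 13266000) + 12 * (377300 / 105417)) * l), sq_nonneg l,
    mul_pos hl hl]

/-- The cubic `Γ(u)` of the final Wronskian is negative up to `21/5` (its only real root is `≈ 4.58`). [folklore] -/
theorem resid38_cubic_neg (u : ℝ) (h2 : u ≤ 21 / 5) :
    (7378 : ℝ) * u ^ 3 + (-23731045210733 / 294289125) * u ^ 2 + (219066474412364411 / 757500207750) * u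
      + (-95868709807612 / 280440225) < 0 := by
  nlinarith [sq_nonneg (u - 797 / 250), mul_nonneg (sq_nonneg (u - 797 / 250)) (sub_nonneg.mpr h2)]

/-- The derivative `Γ′(u)` is positive beyond `21/5`. [folklore] -/
theorem resid38_cubic_deriv_pos (u : ℝ) (h : (21 / 5 : ℝ) < u) :
    0 < 3 * (7378 : ℝ) * u ^ 2 + 2 * (-23731045210733 / 294289125) * u
      + (219066474412364411 / 757500207750) := by
  nlinarith [sq_nonneg (u - 21 / 5)]


/-! ### The three-column residual of `ZP(5..20)` on `(0,2,3,7,21,38)` has at most three positive roots -/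

set_option maxRecDepth 8192 in
/-- **Column-divisor quotient Rolle for the three-column residual.**  For `B₃, B₄, B₅, l > 0` the 6-nomial
`R = B₃X⁷(X² − lν₃) + B₄X²¹(X² − lν₄) + B₅X³⁸(X² − lν₅)` (`ν₃ = 29638973/13266000 < ν₄ = 377300/105417 < ν₅ = 19208/3315`,
the multiplier ratios of the support `(0,2,3,7,21,38)` on the edge `5..20`) has at most THREE positive roots counted
with multiplicity (Descartes allows five).  Proof: every positive root lies beyond `t₃ = √(lν₃)`; quotient Rolle
there with the divisor `B₃X⁷(X² − lν₃)` (no zero beyond `t₃`) leaves `W₁ = U₄ + U₅`, `U_j = Wr(P₃, P_j) =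
B₃B_j X^{6+n_j} Q_j(X²)` with `Q₄` a DEFINITE quadratic; quotient Rolle with the divisor `U₄` leaves
`W₂ = B₃²B₄B₅ X⁷⁰ (X² − lν₃) Γ(X²)` with an explicit cubic `Γ`, negative on `(lν₃, 21l/5]` and increasing beyond —
one more (plain) Rolle step bounds its roots beyond `t₃` by one. [folklore] -/
theorem countP_posRoots_resid38_le_three (B₃ B₄ B₅ l : ℝ) (hB₃ : 0 < B₃) (hB₄ : 0 < B₄) (hB₅ : 0 < B₅)
    (hl : 0 < l) :
    ((C B₃ * X ^ 7 * (X ^ 2 - C (l * (29638973 / 13266000)))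
        + C B₄ * X ^ 21 * (X ^ 2 - C (l * (377300 / 105417)))
        + C B₅ * X ^ 38 * (X ^ 2 - C (l * (19208 / 3315))) : ℝ[X]).roots.countP (fun x => 0 < x)) ≤ 3 := by
  classical
  -- the three multiplier ratios
  set ν₃ : ℝ := 29638973 / 13266000 with hν₃
  set ν₄ : ℝ := 377300 / 105417 with hν₄
  set ν₅ : ℝ := 19208 / 3315 with hν₅
  have hν₃pos : 0 < ν₃ := by rw [hν₃]; norm_num
  have h34 : ν₃ < ν₄ := by rw [hν₃, hν₄]; norm_num
  have h35 : ν₃ < ν₅ := by rw [hν₃, hν₅]; norm_num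
  have hlν₃ : 0 < l * ν₃ := mul_pos hl hν₃pos
  -- the columns and the residual, as monomial sums
  set R : ℝ[X] := C B₃ * X ^ 7 * (X ^ 2 - C (l * ν₃)) + C B₄ * X ^ 21 * (X ^ 2 - C (l * ν₄))
      + C B₅ * X ^ 38 * (X ^ 2 - C (l * ν₅)) with hR
  set P₃ : ℝ[X] := C B₃ * X ^ 9 - C (B₃ * (l * ν₃)) * X ^ 7 with hP₃
  have hRexp : R = C B₃ * X ^ 9 - C (B₃ * (l * ν₃)) * X ^ 7 + (C B₄ * X ^ 23 - C (B₄ * (l * ν₄)) * X ^ 21)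
      + (C B₅ * X ^ 40 - C (B₅ * (l * ν₅)) * X ^ 38) := by
    rw [hR]; simp only [map_mul]; ring
  have evR : ∀ x : ℝ, R.eval x = B₃ * x ^ 7 * (x ^ 2 - l * ν₃) + B₄ * x ^ 21 * (x ^ 2 - l * ν₄)
      + B₅ * x ^ 38 * (x ^ 2 - l * ν₅) := by
    intro x; rw [hR]; simp
  have evP₃ : ∀ x : ℝ, P₃.eval x = B₃ * x ^ 7 * (x ^ 2 - l * ν₃) := by
    intro x; rw [hP₃]; simp; ring
  -- the column zero `t₃ = √(l ν₃)`
  set t₃ : ℝ := Real.sqrt (l * ν₃) with ht₃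
  have ht₃sq : t₃ ^ 2 = l * ν₃ := Real.sq_sqrt hlν₃.le
  have ht₃pos : 0 < t₃ := Real.sqrt_pos.2 hlν₃
  -- STEP 0: no positive root up to `t₃`
  have hRneg : ∀ x : ℝ, 0 < x → x ≤ t₃ → R.eval x < 0 := by
    intro x hx hxt
    have hx2 : x ^ 2 ≤ l * ν₃ := by rw [← ht₃sq]; exact pow_le_pow_left₀ hx.le hxt 2
    have h7 : 0 < x ^ 7 := pow_pos hx 7
    have h21 : 0 < x ^ 21 := pow_pos hx 21
    have h38 : 0 < x ^ 38 := pow_pos hx 38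
    have e3 : B₃ * x ^ 7 * (x ^ 2 - l * ν₃) ≤ 0 :=
      mul_nonpos_of_nonneg_of_nonpos (mul_pos hB₃ h7).le (by linarith)
    have e4 : B₄ * x ^ 21 * (x ^ 2 - l * ν₄) < 0 :=
      mul_neg_of_pos_of_neg (mul_pos hB₄ h21) (by nlinarith)
    have e5 : B₅ * x ^ 38 * (x ^ 2 - l * ν₅) < 0 :=
      mul_neg_of_pos_of_neg (mul_pos hB₅ h38) (by nlinarith)
    rw [evR]; linarith
  have hP₃pos : ∀ x : ℝ, t₃ < x → 0 < P₃.eval x := by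
    intro x hx
    have hx0 : 0 < x := ht₃pos.trans hx
    have hx2 : l * ν₃ < x ^ 2 := by rw [← ht₃sq]; exact pow_lt_pow_left₀ hx ht₃pos.le (by norm_num)
    rw [evP₃]
    exact mul_pos (mul_pos hB₃ (pow_pos hx0 7)) (by linarith)
  have hRne : R ≠ 0 := by
    intro h
    have := hRneg t₃ ht₃pos le_rfl
    rw [h, eval_zero] at this
    exact lt_irrefl _ this
  have step0 : R.roots.countP (fun x => 0 < x) = R.roots.countP (fun x => t₃ < x) := by
    rw [Multiset.countP_eq_card_filter, Multiset.countP_eq_card_filter]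
    congr 1
    refine Multiset.filter_congr fun x hx => ?_
    rw [mem_roots hRne, IsRoot.def] at hx
    constructor
    · intro h0
      by_contra hle
      exact (hRneg x h0 (not_lt.mp hle)).ne hx
    · exact fun h => ht₃pos.trans h
  -- STEP 1: quotient Rolle beyond `t₃` with the divisor `P₃`
  set U₄ : ℝ[X] := C (B₃ * B₄) * X ^ 27 *
      (C (14 * (l ^ 2 * (ν₃ * ν₄))) - C ((16 * ν₃ + 12 * ν₄) * l) * X ^ 2 + C 14 * X ^ 4) with hU₄
  set U₅ : ℝ[X] := C (B₃ * B₅) * X ^ 44 *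
      (C (31 * (l ^ 2 * (ν₃ * ν₅))) - C ((33 * ν₃ + 29 * ν₅) * l) * X ^ 2 + C 31 * X ^ 4) with hU₅
  have hW₁ : U₄ + U₅ = P₃ * derivative R - R * derivative P₃ := by
    apply Polynomial.funext
    intro x
    rw [hRexp, hP₃, hU₄, hU₅]
    simp only [derivative_add, derivative_sub, derivative_mul, derivative_C, derivative_X_pow, zero_mul,
      zero_add, eval_add, eval_sub, eval_mul, eval_C, eval_X, eval_pow]
    push_cast
    ring
  have evU₄ : ∀ x : ℝ, U₄.eval x = B₃ * B₄ * x ^ 27 *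
      (14 * (x ^ 2) ^ 2 - ((16 * ν₃ + 12 * ν₄) * l) * x ^ 2 + 14 * (l ^ 2 * (ν₃ * ν₄))) := by
    intro x; rw [hU₄]; simp only [eval_add, eval_sub, eval_mul, eval_C, eval_X, eval_pow]; ring
  have evU₅ : ∀ x : ℝ, U₅.eval x = B₃ * B₅ * x ^ 44 *
      (31 * (x ^ 2) ^ 2 - ((33 * ν₃ + 29 * ν₅) * l) * x ^ 2 + 31 * (l ^ 2 * (ν₃ * ν₅))) := by
    intro x; rw [hU₅]; simp only [eval_add, eval_sub, eval_mul, eval_C, eval_X, eval_pow]; ring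
  have hU₄pos : ∀ x : ℝ, 0 < x → 0 < U₄.eval x := by
    intro x hx
    rw [evU₄]
    refine mul_pos (mul_pos (mul_pos hB₃ hB₄) (pow_pos hx 27)) ?_
    have := resid38_quad_pos (x ^ 2) l hl
    rw [hν₃, hν₄]; linarith
  have hW₁ne : U₄ + U₅ ≠ 0 := by
    intro h
    have h0 := congrArg (fun p => p.eval t₃) h
    simp only [eval_add, eval_zero] at h0
    have h4 := hU₄pos t₃ ht₃pos
    have h5 : 0 < U₅.eval t₃ := by
      rw [evU₅, ht₃sq]
      refine mul_pos (mul_pos (mul_pos hB₃ hB₅) (pow_pos ht₃pos 44)) ?_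
      have : 31 * (l * ν₃) ^ 2 - (33 * ν₃ + 29 * ν₅) * l * (l * ν₃) + 31 * (l ^ 2 * (ν₃ * ν₅))
          = 2 * l ^ 2 * ν₃ * (ν₅ - ν₃) := by ring
      rw [this]
      have : 0 < ν₅ - ν₃ := by linarith
      positivity
    linarith
  have step1 : R.roots.countP (fun x => t₃ < x) ≤ (U₄ + U₅).roots.countP (fun x => t₃ < x) + 1 :=
    countP_roots_gt_le_wronskian_add_one R P₃ (U₄ + U₅) t₃ hW₁ hW₁ne
      (fun x hx => (hP₃pos x hx).ne')
  -- STEP 2: quotient Rolle beyond `t₃` with the divisor `U₄` (zero-free on `(0, ∞)`)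
  set Γp : ℝ[X] := C (7378 : ℝ) * X ^ 6 + C ((-23731045210733 / 294289125) * l) * X ^ 4
      + C ((219066474412364411 / 757500207750) * l ^ 2) * X ^ 2 + C ((-95868709807612 / 280440225) * l ^ 3)
    with hΓp
  set W₂ : ℝ[X] := C (B₃ ^ 2 * B₄ * B₅) * X ^ 70 * ((X ^ 2 - C (l * ν₃)) * Γp) with hW₂
  have hW₂id : W₂ = U₄ * derivative (U₄ + U₅) - (U₄ + U₅) * derivative U₄ := by
    have e4 : U₄ = C (B₃ * B₄ * (14 * (l ^ 2 * (ν₃ * ν₄)))) * X ^ 27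
        - C (B₃ * B₄ * ((16 * ν₃ + 12 * ν₄) * l)) * X ^ 29 + C (B₃ * B₄ * 14) * X ^ 31 := by
      rw [hU₄]; simp only [map_mul]; ring
    have e5 : U₅ = C (B₃ * B₅ * (31 * (l ^ 2 * (ν₃ * ν₅)))) * X ^ 44
        - C (B₃ * B₅ * ((33 * ν₃ + 29 * ν₅) * l)) * X ^ 46 + C (B₃ * B₅ * 31) * X ^ 48 := by
      rw [hU₅]; simp only [map_mul]; ring
    apply Polynomial.funext
    intro x
    rw [hW₂, hΓp, e4, e5, hν₃, hν₄, hν₅]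
    simp only [derivative_add, derivative_sub, derivative_mul, derivative_C, derivative_X_pow, zero_mul,
      zero_add, eval_add, eval_sub, eval_mul, eval_C, eval_X, eval_pow]
    push_cast
    ring
  -- evaluations of `Γp` and `Γp′` through `u = x² / l`
  have evΓp : ∀ x u : ℝ, x ^ 2 = l * u → Γp.eval x = l ^ 3 * ((7378 : ℝ) * u ^ 3
      + (-23731045210733 / 294289125) * u ^ 2 + (219066474412364411 / 757500207750) * u
      + (-95868709807612 / 280440225)) := by
    intro x u hxu
    have e6 : x ^ 6 = (x ^ 2) ^ 3 := by ring
    have e4 : x ^ 4 = (x ^ 2) ^ 2 := by ring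
    rw [hΓp]
    simp only [eval_add, eval_mul, eval_C, eval_X, eval_pow]
    rw [e6, e4, hxu]
    ring
  have evΓp' : ∀ x u : ℝ, x ^ 2 = l * u → (derivative Γp).eval x = 2 * x * l ^ 2 * (3 * (7378 : ℝ) * u ^ 2
      + 2 * (-23731045210733 / 294289125) * u + (219066474412364411 / 757500207750)) := by
    intro x u hxu
    have e5 : x ^ 5 = x * (x ^ 2) ^ 2 := by ring
    have e3 : x ^ 3 = x * x ^ 2 := by ring
    rw [hΓp]
    simp only [derivative_add, derivative_mul, derivative_C, derivative_X_pow, zero_mul, zero_add, add_zero,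
      eval_add, eval_mul, eval_C, eval_X, eval_pow]
    push_cast
    rw [e5, e3, hxu]
    ring
  -- the probe point `x₅ = √(5 l)` (`u = 5`): `Γp(x₅) > 0`, hence `W₂ ≠ 0`, `Γp ≠ 0`, `Γp′ ≠ 0`
  set x₅ : ℝ := Real.sqrt (l * 5) with hx₅
  have hx₅sq : x₅ ^ 2 = l * 5 := Real.sq_sqrt (by positivity)
  have hx₅pos : 0 < x₅ := Real.sqrt_pos.2 (by positivity)
  have hΓx₅ : 0 < Γp.eval x₅ := by
    rw [evΓp x₅ 5 hx₅sq]
    exact mul_pos (pow_pos hl 3) (by norm_num)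
  have hΓ'x₅ : 0 < (derivative Γp).eval x₅ := by
    rw [evΓp' x₅ 5 hx₅sq]
    exact mul_pos (by positivity) (by norm_num)
  have hΓne : Γp ≠ 0 := fun h => by rw [h, eval_zero] at hΓx₅; exact lt_irrefl _ hΓx₅
  have hΓ'ne : derivative Γp ≠ 0 := fun h => by rw [h, eval_zero] at hΓ'x₅; exact lt_irrefl _ hΓ'x₅
  have hκ : 0 < B₃ ^ 2 * B₄ * B₅ := by positivity
  have hQne : (X ^ 2 - C (l * ν₃)) * Γp ≠ 0 := by
    refine mul_ne_zero (fun h => ?_) hΓne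
    have h0 := congrArg (fun p => p.eval x₅) h
    simp only [eval_sub, eval_pow, eval_X, eval_C, eval_zero, hx₅sq] at h0
    have : ν₃ < 5 := by rw [hν₃]; norm_num
    nlinarith
  have hXQne : (X : ℝ[X]) ^ 70 * ((X ^ 2 - C (l * ν₃)) * Γp) ≠ 0 := mul_ne_zero (pow_ne_zero _ X_ne_zero) hQne
  have hW₂ne : W₂ ≠ 0 := by
    rw [hW₂, mul_assoc]
    exact mul_ne_zero (by rw [Ne, C_eq_zero]; exact hκ.ne') hXQne
  have step2 : (U₄ + U₅).roots.countP (fun x => t₃ < x) ≤ W₂.roots.countP (fun x => t₃ < x) + 1 :=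
    countP_roots_gt_le_wronskian_add_one (U₄ + U₅) U₄ W₂ t₃ hW₂id hW₂ne
      (fun x hx => (hU₄pos x (ht₃pos.trans hx)).ne')
  -- STEP 3a: beyond `t₃`, the roots of `W₂` are the roots of `Γp`
  have step3a : W₂.roots.countP (fun x => t₃ < x) = Γp.roots.countP (fun x => t₃ < x) := by
    rw [hW₂, mul_assoc, roots_C_mul _ hκ.ne', roots_mul hXQne, Multiset.countP_add, roots_pow, roots_X,
      roots_mul hQne, Multiset.countP_add]
    have z1 : Multiset.countP (fun x => t₃ < x) (70 • ({0} : Multiset ℝ)) = 0 := by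
      rw [Multiset.countP_eq_zero]
      intro x hx
      rw [Multiset.mem_nsmul] at hx
      rw [Multiset.mem_singleton.mp hx.2]
      exact not_lt.mpr ht₃pos.le
    have z2 : Multiset.countP (fun x => t₃ < x) (X ^ 2 - C (l * ν₃) : ℝ[X]).roots = 0 := by
      rw [Multiset.countP_eq_zero]
      intro x hx
      have hne : (X ^ 2 - C (l * ν₃) : ℝ[X]) ≠ 0 := (mul_ne_zero_iff.mp hQne).1
      rw [mem_roots hne, IsRoot.def] at hx
      simp only [eval_sub, eval_pow, eval_X, eval_C] at hx
      intro hlt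
      have : t₃ ^ 2 < x ^ 2 := pow_lt_pow_left₀ hlt ht₃pos.le (by norm_num)
      rw [ht₃sq] at this
      linarith
    rw [z1, z2]
    simp
  -- STEP 3b: `Γp` has no root in `(t₃, t_m]`, `t_m = √(21 l / 5)`
  set tm : ℝ := Real.sqrt (l * (21 / 5)) with htm
  have htmsq : tm ^ 2 = l * (21 / 5) := Real.sq_sqrt (by positivity)
  have htmpos : 0 < tm := Real.sqrt_pos.2 (by positivity)
  have ht₃tm : t₃ < tm := by
    rw [ht₃, htm]
    exact Real.sqrt_lt_sqrt hlν₃.le (mul_lt_mul_of_pos_left (by rw [hν₃]; norm_num) hl)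
  have hΓneg : ∀ x : ℝ, t₃ < x → x ≤ tm → Γp.eval x < 0 := by
    intro x hx hxm
    have hx0 : 0 < x := ht₃pos.trans hx
    have hxu : x ^ 2 = l * (x ^ 2 / l) := by field_simp
    rw [evΓp x (x ^ 2 / l) hxu]
    refine mul_neg_of_pos_of_neg (pow_pos hl 3) (resid38_cubic_neg _ ?_)
    rw [div_le_iff₀ hl]
    have : x ^ 2 ≤ tm ^ 2 := pow_le_pow_left₀ hx0.le hxm 2
    rw [htmsq] at this
    linarith
  have step3b : Γp.roots.countP (fun x => t₃ < x) = Γp.roots.countP (fun x => tm < x) := by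
    rw [Multiset.countP_eq_card_filter, Multiset.countP_eq_card_filter]
    congr 1
    refine Multiset.filter_congr fun x hx => ?_
    rw [mem_roots hΓne, IsRoot.def] at hx
    constructor
    · intro h0
      by_contra hle
      exact (hΓneg x h0 (not_lt.mp hle)).ne hx
    · exact fun h => ht₃tm.trans h
  -- STEP 3c: beyond `t_m`, `Γp′ > 0`, so at most one root (plain Rolle with multiplicity)
  have hΓ'pos : ∀ x : ℝ, tm < x → 0 < (derivative Γp).eval x := by
    intro x hx
    have hx0 : 0 < x := htmpos.trans hx
    have hxu : x ^ 2 = l * (x ^ 2 / l) := by field_simp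
    rw [evΓp' x (x ^ 2 / l) hxu]
    refine mul_pos (by positivity) (resid38_cubic_deriv_pos _ ?_)
    rw [lt_div_iff₀ hl]
    have : tm ^ 2 < x ^ 2 := pow_lt_pow_left₀ hx htmpos.le (by norm_num)
    rw [htmsq] at this
    linarith
  have step3c : Γp.roots.countP (fun x => tm < x) ≤ (derivative Γp).roots.countP (fun x => tm < x) + 1 :=
    countP_roots_gt_le_wronskian_add_one Γp (C 1) (derivative Γp) tm (by simp) hΓ'ne
      (fun x _ => by simp)
  have step3d : (derivative Γp).roots.countP (fun x => tm < x) = 0 := by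
    rw [Multiset.countP_eq_zero]
    intro x hx hlt
    rw [mem_roots hΓ'ne, IsRoot.def] at hx
    exact (hΓ'pos x hlt).ne' hx
  -- assembly
  rw [step0]
  calc R.roots.countP (fun x => t₃ < x)
      ≤ (U₄ + U₅).roots.countP (fun x => t₃ < x) + 1 := step1
    _ ≤ W₂.roots.countP (fun x => t₃ < x) + 1 + 1 := by gcongr
    _ = Γp.roots.countP (fun x => tm < x) + 2 := by rw [step3a, step3b]
    _ ≤ (derivative Γp).roots.countP (fun x => tm < x) + 1 + 2 := by gcongr
    _ = 3 := by rw [step3d]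

end Summit.ValiantsHypothesis.ValiantsHypothesis.Theorems.LacunarySymmetroidMatrixDescartes.Census
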